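import Mathlib
import Literature.NumberTheory.LFunctions.Zhang2022.Section7dStatements
import Literature.NumberTheory.LFunctions.Zhang2022.Section7KappaEulerLocal
import HarnessLib

/-!
# Zhang (2022) §7 p. 40: the Euler-product identity behind (7.19) — node `Z22:§7.u045`, DISCHARGED

Topic `Literature/NumberTheory/LFunctions/Zhang2022` (Landau–Siegel audit tree; verdict-neutral).
Y. Zhang, *Discrete mean estimates and the Landau–Siegel zero*, arXiv:2211.02515v1 (2022)
[Zhang2022LandauSiegel] — **an unrefereed manuscript under adjudication.** Cell siegel-zhang
(D-0069 width campaign), DISCHARGE of one proof-internal step of Proposition 7.1, part (c)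
("the main term", §7 p. 40, tex L2100–L2102), at the Mellin integral (7.19):

> Every `l` with `(l, d₂k) = 1` can be uniquely written as `l = hr` such that `h ∈ 𝔫(d₁)`,
> `(h, d₂k) = 1` and `(r, d₁d₂k) = 1`. Hence
> `Σ_{(l,kd₂)=1} κ(d₁l) l^{−s} = κ̃(d₁;d₂k,s) λ(d₁d₂k,s) ζ(s+β₁)ζ(s+β₂)ζ(s+β₃)/ζ(s)`.

(`𝔫`, `κ̃`, `λ` as on §7 p. 32; `Σ_n κ(n)n^{−s} = ζ(s+β₁)ζ(s+β₂)ζ(s+β₃)/ζ(s)`, p. 34). The typed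
claim is `Section7dStatements.Step7u045 c'` (L2-t5, p412033; DAG node `Z22:§7.u045`; the unique
factorisation is `Step7u045a`), for `σ > 1`, over `Skeleton.kappaZ / kappaTilde / lam` and the
typing's `kapSer`, `zetaRatio`. **This file proves it**: `Section7dStatements.step7u045_holds :
∀ c′, Step7u045 c′` (0 new facts, 0 `sorry`, standard axioms; no numerical input).

## Proof (the printed argument, made explicit; elementary ingredients in `Section7KappaEulerLocal`)

* *the splitting* (companion file, §1–§2): for a finite set `S` of primes every `l ≥ 1` is uniquely
  `a·b` with `a` `S`-factored (`Nat.factoredNumbers S` = Zhang's `𝔫(d)` for `S = primeFactors d`,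
  `mem_nset_iff` below) and `b` free of the primes of `S`; hence a Dirichlet convolution `A ∗ B` of
  an `S`-supported `A` and an `S`-free `B` has the single term `A(a)B(b)` at `l`. With
  `S = primeFactors d₁`, `A(h) = 𝟙[h ∈ 𝔫(d₁), (h,m)=1]κ(d₁h)`, `B(r) = 𝟙[(r,d₁m)=1]κ(r)` and the
  multiplicativity of `κ` (`κ(d₁hr) = κ(d₁h)κ(r)`): `𝟙[(l,m)=1]κ(d₁l) = (A ∗ B)(l)`
  (`split_conv_apply`), so the left side of the display is `L(A,s)·L(B,s) = κ̃(d₁;m,s)·L(B,s)`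
  (`LSeries_convolution'`, absolute convergence for `σ > 1` from the tree's `LSeriesSummable_kappa`).
* *the Euler product* (§1 below): `Σ_{(r,N)=1} κ(r)r^{−s} = λ(N,s)·Σ_n κ(n)n^{−s}`. Again by the
  splitting, `κ = κ𝟙_{𝔫(N)} ∗ κ𝟙_{(·,N)=1}`; the `𝔫(N)`-restricted series is Mathlib's Euler product
  over `N.primeFactors`-factored numbers
  (`EulerProduct.summable_and_hasSum_factoredNumbers_prod_filter_prime_tsum`), a FINITE product of
  the local factors `Σ_e κ(q^e)q^{−es} = (1 − q^{−s})/∏_j(1 − q^{−(s+β_j)})` (companion file,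
  `KappaEuler.tsum_prime_pow_kappa`, from `κ = n^{−β₁} ∗ n^{−β₂} ∗ n^{−β₃} ∗ μ`). This finite
  product is `λ(N,s)⁻¹` (`lam_mul_prod_eq_one`), and `Σ_n κ(n)n^{−s}` is the tree's
  `MeanSquareMajorant.LSeries_kappa` (`LSeries_kappaZ`, with `β_j = ib_j`, `beta1_eq`–`beta3_eq`).

Valid for every `D : ℕ`; nothing depends on (A) or on analytic input. WHAT THIS IS NOT: any statement about Theorems 1–2 of the manuscript or about Landau–Siegel zeros;
a discharge of (7.19)'s contour step (`Step7u047/049`, which USE this identity) or of the bounds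
`Step7u046` (separate file). typed ≠ discharged elsewhere: this closes `Z22:§7.u045` only.

## References

* Y. Zhang, arXiv:2211.02515v1 (2022), §7 p. 32 (definitions of `𝔫`, `κ̃`, `λ`), p. 34
  (definition of `κ`), p. 40 (the display after (7.19)), tex L1789–L1797, L1868, L2100–L2102.
  [cite: Zhang2022LandauSiegel, §7 p.40]
* E. C. Titchmarsh, *The Theory of the Riemann Zeta-Function* (1986), §1.1. [cite: Titchmarsh1986, §1.1]
-/

noncomputable section

open Complex LSeries ArithmeticFunction Finset
open scoped LSeries.notation

namespace Literature.NumberTheory.LFunctions.Zhang2022.KappaEuler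

/-! ### §1. The `L`-series of `κ` restricted to `𝔫(N)` and to the integers coprime to `N` -/

section Global

open MeanSquareMajorant (kappa isMultiplicative_kappa LSeriesSummable_kappa LSeries_kappa)

variable {s : ℂ}

/-- An `L`-series dominated termwise by an absolutely convergent one converges absolutely.
[folklore] -/
private theorem lseriesSummable_of_norm_le {f g : ℕ → ℂ} (hg : LSeriesSummable g s)
    (h : ∀ n, ‖f n‖ ≤ ‖g n‖) : LSeriesSummable f s := by
  refine Summable.of_norm_bounded hg.norm fun n => ?_
  rcases eq_or_ne n 0 with rfl | hn
  · simp
  · rw [LSeries.term_of_ne_zero hn, LSeries.term_of_ne_zero hn, norm_div, norm_div]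
    exact div_le_div_of_nonneg_right (h n) (norm_nonneg _)

/-- `‖q^{−s}‖ < 1` for a prime `q` and `Re s > 0`. [folklore] -/
private theorem norm_natCast_cpow_neg_lt_one {q : ℕ} (hq : q.Prime) (hs : 0 < s.re) :
    ‖(q : ℂ) ^ (-s)‖ < 1 := by
  rw [Complex.norm_natCast_cpow_of_pos hq.pos, Complex.neg_re]
  exact Real.rpow_lt_one_of_one_lt_of_neg (by exact_mod_cast hq.one_lt) (by linarith)

/-- `(q^e)^s = (q^s)^e` for naturals `q, e` and complex `s`. [folklore] -/
private theorem natCast_pow_cpow' (q e : ℕ) (s : ℂ) : ((q ^ e : ℕ) : ℂ) ^ s = ((q : ℂ) ^ s) ^ e := by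
  induction e with
  | zero => simp
  | succ e ih => rw [pow_succ, Nat.cast_mul, Complex.natCast_mul_natCast_cpow, ih, pow_succ]

/-- The `L`-series term of an arithmetic function at a prime power: `f(q^e)(q^e)^{−s} = f(q^e)(q^{−s})^e`.
[folklore] -/
private theorem term_prime_pow (f : ArithmeticFunction ℂ) {q : ℕ} (hq : q.Prime) (s : ℂ) (e : ℕ) :
    term (fun n => f n) s (q ^ e) = f (q ^ e) * ((q : ℂ) ^ (-s)) ^ e := by
  rw [LSeries.term_of_ne_zero (pow_ne_zero e hq.ne_zero), div_eq_mul_inv, Nat.cast_pow,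
    ← Nat.cast_pow, natCast_pow_cpow', ← inv_pow, Complex.cpow_neg]

/-- The `L`-series terms of a multiplicative function are multiplicative on coprime arguments.
[folklore] -/
private theorem term_mul_of_coprime {f : ArithmeticFunction ℂ} (hf : f.IsMultiplicative) (s : ℂ) {m n : ℕ}
    (hmn : Nat.Coprime m n) :
    term (fun k => f k) s (m * n) = term (fun k => f k) s m * term (fun k => f k) s n := by
  rcases eq_or_ne m 0 with rfl | hm
  · simp
  rcases eq_or_ne n 0 with rfl | hn
  · simp
  rw [LSeries.term_of_ne_zero (mul_ne_zero hm hn), LSeries.term_of_ne_zero hm,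
    LSeries.term_of_ne_zero hn, hf.map_mul_of_coprime hmn, Nat.cast_mul,
    Complex.natCast_mul_natCast_cpow, div_mul_div_comm]

/-- Zhang's `𝔫(N)` (the positive integers all of whose prime factors divide `N`) is Mathlib's set of
`N.primeFactors`-factored numbers (`N ≥ 1`). [cite: Zhang2022LandauSiegel, §7 p.32, tex L1789] -/
theorem mem_nset_iff {N h : ℕ} (hN : N ≠ 0) :
    h ∈ Skeleton.nset N ↔ h ∈ Nat.factoredNumbers N.primeFactors := by
  rw [Nat.mem_factoredNumbers_iff_primeFactors_subset, Skeleton.nset, Set.mem_setOf_eq]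
  constructor
  · rintro ⟨hh, hq⟩
    refine ⟨hh.ne', fun q hqm => ?_⟩
    have hq' := Nat.mem_primeFactors.mp hqm
    exact Nat.mem_primeFactors.mpr ⟨hq'.1, hq q hq'.1 hq'.2.1, hN⟩
  · rintro ⟨hh, hsub⟩
    refine ⟨Nat.pos_of_ne_zero hh, fun q hq hqh => ?_⟩
    exact (Nat.mem_primeFactors.mp (hsub (Nat.mem_primeFactors.mpr ⟨hq, hqh, hh⟩))).2.1

variable (b₁ b₂ b₃ : ℝ)

/-- **Euler product over `𝔫(N)`**: for `Re s > 1` and a finite set `S` of primes,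
`Σ_{h : primes of h ⊆ S} κ(h)h^{−s} = ∏_{q ∈ S} Σ_e κ(q^e)q^{−es}` (Mathlib's Euler product over
`S`-factored numbers, for the multiplicative `κ`). [folklore] -/
private theorem hasSum_factoredNumbers_kappa (hs : 1 < s.re) {S : Finset ℕ} (hS : ∀ q ∈ S, q.Prime) :
    HasSum (fun m : Nat.factoredNumbers S => term (fun n => kappa b₁ b₂ b₃ n) s m)
      (∏ q ∈ S, ∑' e : ℕ, kappa b₁ b₂ b₃ (q ^ e) * ((q : ℂ) ^ (-s)) ^ e) := by
  have hκ := LSeriesSummable_kappa b₁ b₂ b₃ hs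
  have h1 : term (fun n => kappa b₁ b₂ b₃ n) s 1 = 1 := by
    rw [LSeries.term_of_ne_zero one_ne_zero, (isMultiplicative_kappa b₁ b₂ b₃).map_one,
      Nat.cast_one, Complex.one_cpow, div_one]
  have key := EulerProduct.summable_and_hasSum_factoredNumbers_prod_filter_prime_tsum
    (f := term (fun n => kappa b₁ b₂ b₃ n) s) h1
    (fun hmn => term_mul_of_coprime (isMultiplicative_kappa b₁ b₂ b₃) s hmn)
    (fun hp => hκ.norm.comp_injective (Nat.pow_right_injective hp.two_le)) S
  have hfilter : S.filter Nat.Prime = S := Finset.filter_true_of_mem hS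
  have hprod : (∏ q ∈ S, ∑' e : ℕ, term (fun n => kappa b₁ b₂ b₃ n) s (q ^ e)) =
      ∏ q ∈ S, ∑' e : ℕ, kappa b₁ b₂ b₃ (q ^ e) * ((q : ℂ) ^ (-s)) ^ e :=
    Finset.prod_congr rfl fun q hq => tsum_congr fun e => term_prime_pow _ (hS q hq) s e
  rw [hfilter, hprod] at key
  exact key.2

/-- **The closed form of the Euler product over `𝔫(N)`** (`Re s > 1`):
`∏_{q ∈ S} Σ_e κ(q^e)q^{−es} = ∏_{q ∈ S} (1 − q^{−s})/((1 − q^{−(s+ib₁)})(1 − q^{−(s+ib₂)})(1 − q^{−(s+ib₃)}))`.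
[folklore] -/
private theorem prod_tsum_kappa_eq (hs : 1 < s.re) {S : Finset ℕ} (hS : ∀ q ∈ S, q.Prime) :
    ∏ q ∈ S, ∑' e : ℕ, kappa b₁ b₂ b₃ (q ^ e) * ((q : ℂ) ^ (-s)) ^ e =
      ∏ q ∈ S, (1 - (q : ℂ) ^ (-(s + b₁ * I)))⁻¹ * (1 - (q : ℂ) ^ (-(s + b₂ * I)))⁻¹ *
        (1 - (q : ℂ) ^ (-(s + b₃ * I)))⁻¹ * (1 - (q : ℂ) ^ (-s)) := by
  refine Finset.prod_congr rfl fun q hq => ?_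
  have hq' := hS q hq
  have hq0 : (q : ℂ) ≠ 0 := by exact_mod_cast hq'.ne_zero
  have hx : ‖(q : ℂ) ^ (-s)‖ < 1 := norm_natCast_cpow_neg_lt_one hq' (by linarith)
  have hexp : ∀ b : ℝ, (q : ℂ) ^ (-(b * I)) * (q : ℂ) ^ (-s) = (q : ℂ) ^ (-(s + b * I)) := fun b => by
    rw [← Complex.cpow_add _ _ hq0]; congr 1; ring
  rw [tsum_prime_pow_kappa b₁ b₂ b₃ hq' hx, hexp, hexp, hexp]

/-- Each local factor `1 − q^{−w}` (`Re w > 0`) is non-zero. [folklore] -/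
private theorem one_sub_cpow_ne_zero {q : ℕ} (hq : q.Prime) {w : ℂ} (hw : 0 < w.re) :
    (1 : ℂ) - (q : ℂ) ^ (-w) ≠ 0 := by
  intro h
  have h1 : ‖(q : ℂ) ^ (-w)‖ = 1 := by rw [← sub_eq_zero.mp h, norm_one]
  exact (norm_natCast_cpow_neg_lt_one hq hw).ne h1

/-- **`Σ_{h ∈ 𝔫(N)} κ(h)h^{−s}` as an Euler product**: for `N ≥ 1` and `Re s > 1`, the `L`-series of
`κ` restricted to `𝔫(N)` equals `∏_{q ∣ N} (1 − q^{−s})/∏_j(1 − q^{−(s+ib_j)})`.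
[cite: Zhang2022LandauSiegel, §7 p.40, tex L2101] -/
theorem LSeries_indicator_nset (hs : 1 < s.re) {N : ℕ} (hN : N ≠ 0) :
    LSeries ((Skeleton.nset N).indicator fun n => kappa b₁ b₂ b₃ n) s =
      ∏ q ∈ N.primeFactors, (1 - (q : ℂ) ^ (-(s + b₁ * I)))⁻¹ * (1 - (q : ℂ) ^ (-(s + b₂ * I)))⁻¹ *
        (1 - (q : ℂ) ^ (-(s + b₃ * I)))⁻¹ * (1 - (q : ℂ) ^ (-s)) := by
  have hS : ∀ q ∈ N.primeFactors, q.Prime := fun q hq => Nat.prime_of_mem_primeFactors hq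
  rw [← prod_tsum_kappa_eq b₁ b₂ b₃ hs hS, ← (hasSum_factoredNumbers_kappa b₁ b₂ b₃ hs hS).tsum_eq,
    tsum_subtype (Nat.factoredNumbers N.primeFactors) (term (fun n => kappa b₁ b₂ b₃ n) s), LSeries]
  refine tsum_congr fun n => ?_
  by_cases hn : n ∈ Skeleton.nset N
  · have hn' : n ∈ Nat.factoredNumbers N.primeFactors := (mem_nset_iff hN).mp hn
    have hn0 : n ≠ 0 := hn.1.ne'
    rw [Set.indicator_of_mem hn', LSeries.term_of_ne_zero hn0, LSeries.term_of_ne_zero hn0,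
      Set.indicator_of_mem hn]
  · have hn' : n ∉ Nat.factoredNumbers N.primeFactors := fun h => hn ((mem_nset_iff hN).mpr h)
    rw [Set.indicator_of_notMem hn']
    rcases eq_or_ne n 0 with rfl | hn0
    · simp
    · rw [LSeries.term_of_ne_zero hn0, Set.indicator_of_notMem hn, zero_div]

/-- The indicator of `𝔫(N)` vanishes off the `N.primeFactors`-factored numbers. [folklore] -/
private theorem indicator_nset_eq_zero {N : ℕ} (hN : N ≠ 0) (g : ℕ → ℂ) {a : ℕ}
    (ha : a ∉ Nat.factoredNumbers N.primeFactors) : (Skeleton.nset N).indicator g a = 0 :=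
  Set.indicator_of_notMem (fun h => ha ((mem_nset_iff hN).mp h)) g

/-- The indicator of "coprime to `N`" vanishes on multiples of primes of `N`. [folklore] -/
private theorem indicator_coprime_eq_zero {N : ℕ} (g : ℕ → ℂ) {b q : ℕ} (hq : q ∈ N.primeFactors)
    (hqb : q ∣ b) : {r | Nat.Coprime r N}.indicator g b = 0 := by
  refine Set.indicator_of_notMem (fun hb => ?_) g
  have hq' := Nat.mem_primeFactors.mp hq
  have h1 : q ∣ Nat.gcd b N := Nat.dvd_gcd hqb hq'.2.1
  rw [Set.mem_setOf_eq.mp hb] at h1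
  exact hq'.1.one_lt.ne' (Nat.dvd_one.mp h1)

/-- **`κ = κ𝟙_{𝔫(N)} ∗ κ𝟙_{(·,N)=1}`** (unique splitting `n = hr`, `κ(hr) = κ(h)κ(r)`).
[folklore] -/
private theorem indicator_nset_conv_indicator_coprime {N : ℕ} (hN : N ≠ 0) {n : ℕ} (hn : n ≠ 0) :
    (((Skeleton.nset N).indicator fun k => kappa b₁ b₂ b₃ k) ⍟
        ({r | Nat.Coprime r N}.indicator fun k => kappa b₁ b₂ b₃ k)) n = kappa b₁ b₂ b₃ n := by
  obtain ⟨a, b, hab, ha, hb⟩ := exists_split N.primeFactors hn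
  rw [convolution_eq_of_split (fun a ha => indicator_nset_eq_zero hN _ ha)
    (fun b q hq _ hqb => indicator_coprime_eq_zero _ hq hqb) hn hab ha hb]
  have hbN : Nat.Coprime b N := coprime_of_split' hb hN subset_rfl
  have hba : Nat.Coprime b a := coprime_of_split hb ha
  rw [Set.indicator_of_mem ((mem_nset_iff hN).mpr ha), Set.indicator_of_mem (by exact hbN),
    ← (isMultiplicative_kappa b₁ b₂ b₃).map_mul_of_coprime hba.symm, hab]

/-- **`Σ_{(r,N)=1} κ(r)r^{−s}` via the Euler product** (`N ≥ 1`, `Re s > 1`):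
`(Σ_{(r,N)=1} κ(r)r^{−s}) · ∏_{q∣N}(1 − q^{−s})/∏_j(1 − q^{−(s+ib_j)}) = Σ_n κ(n)n^{−s}`.
[cite: Zhang2022LandauSiegel, §7 p.40, tex L2101] -/
theorem LSeries_indicator_coprime_mul (hs : 1 < s.re) {N : ℕ} (hN : N ≠ 0) :
    LSeries ({r | Nat.Coprime r N}.indicator fun n => kappa b₁ b₂ b₃ n) s *
        ∏ q ∈ N.primeFactors, (1 - (q : ℂ) ^ (-(s + b₁ * I)))⁻¹ * (1 - (q : ℂ) ^ (-(s + b₂ * I)))⁻¹ *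
          (1 - (q : ℂ) ^ (-(s + b₃ * I)))⁻¹ * (1 - (q : ℂ) ^ (-s)) =
      LSeries (fun n => kappa b₁ b₂ b₃ n) s := by
  have hκ := LSeriesSummable_kappa b₁ b₂ b₃ hs
  have hC : LSeriesSummable ((Skeleton.nset N).indicator fun n => kappa b₁ b₂ b₃ n) s :=
    lseriesSummable_of_norm_le hκ fun n => norm_indicator_le_norm_self _ _
  have hB : LSeriesSummable ({r | Nat.Coprime r N}.indicator fun n => kappa b₁ b₂ b₃ n) s :=
    lseriesSummable_of_norm_le hκ fun n => norm_indicator_le_norm_self _ _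
  rw [← LSeries_indicator_nset b₁ b₂ b₃ hs hN, mul_comm, ← LSeries_convolution' hC hB]
  exact LSeries_congr (fun hn => indicator_nset_conv_indicator_coprime b₁ b₂ b₃ hN hn) s

end Global

/-! ### §2. Zhang's objects: `κ̃(d₁;m,s)`, `λ(d₁m,s)`, and the node `Z22:§7.u045` -/

section Zhang

open MeanSquareMajorant (kappa isMultiplicative_kappa LSeriesSummable_kappa LSeries_kappa)

variable (c' : ℝ) (D : ℕ) {s : ℂ}

/-- `β₁ = ib₁` ((2.13), with the real shift size `b₁` of `SkeletonMeanValue`). [cite: Zhang2022LandauSiegel, §2 (2.13)] -/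
theorem beta1_eq : Skeleton.beta1 c' D = (Skeleton.b1 c' D : ℂ) * I := by
  rw [Skeleton.beta1, Skeleton.b1]; push_cast; ring

/-- `β₂ = ib₂`. [cite: Zhang2022LandauSiegel, §2 (2.13)] -/
theorem beta2_eq : Skeleton.beta2 c' D = (Skeleton.b2 c' D : ℂ) * I := by
  rw [Skeleton.beta2, Skeleton.b2]; push_cast; ring

/-- `β₃ = ib₃`. [cite: Zhang2022LandauSiegel, §2 (2.13)] -/
theorem beta3_eq : Skeleton.beta3 c' D = (Skeleton.b3 c' D : ℂ) * I := by
  rw [Skeleton.beta3, Skeleton.b3]; push_cast; ring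

/-- **`Σ_n κ(n)n^{−s} = ζ(s+β₁)ζ(s+β₂)ζ(s+β₃)/ζ(s)`** for the skeleton's `κ` (`Re s > 1`): the tree's
`MeanSquareMajorant.LSeries_kappa` in the §7 typing's vocabulary (`zetaRatio`).
[cite: Zhang2022LandauSiegel, §7 p.34, tex L1868] -/
theorem LSeries_kappaZ (hs : 1 < s.re) :
    LSeries (fun n => Skeleton.kappaZ c' D n) s = Section7dStatements.zetaRatio c' D s := by
  rw [Section7dStatements.zetaRatio, beta1_eq, beta2_eq, beta3_eq, Skeleton.kappaZ]
  exact LSeries_kappa _ _ _ hs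

/-- Cancellation of one local factor against its reciprocal. [folklore] -/
private theorem factor_cancel {a b c d : ℂ} (ha : 1 - a ≠ 0) (hb : 1 - b ≠ 0) (hc : 1 - c ≠ 0)
    (hd : 1 - d ≠ 0) :
    (1 - a) * (1 - b) * (1 - c) / (1 - d) * ((1 - a)⁻¹ * (1 - b)⁻¹ * (1 - c)⁻¹ * (1 - d)) = 1 := by
  field_simp

/-- **`λ(N,s)` is the reciprocal of the Euler product over `q ∣ N`** (`Re s > 0`):
`λ(N,s) · ∏_{q∣N}(1 − q^{−s})/∏_j(1 − q^{−(s+β_j)}) = 1`. [cite: Zhang2022LandauSiegel, §7 p.32, tex L1795] -/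
theorem lam_mul_prod_eq_one (hs : 0 < s.re) (N : ℕ) :
    Skeleton.lam c' D N s *
        ∏ q ∈ N.primeFactors, (1 - (q : ℂ) ^ (-(s + Skeleton.b1 c' D * I)))⁻¹ *
          (1 - (q : ℂ) ^ (-(s + Skeleton.b2 c' D * I)))⁻¹ *
          (1 - (q : ℂ) ^ (-(s + Skeleton.b3 c' D * I)))⁻¹ * (1 - (q : ℂ) ^ (-s)) = 1 := by
  rw [Skeleton.lam, beta1_eq, beta2_eq, beta3_eq, ← Finset.prod_mul_distrib]
  refine Finset.prod_eq_one fun q hq => ?_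
  have hq' : q.Prime := Nat.prime_of_mem_primeFactors hq
  exact factor_cancel (one_sub_cpow_ne_zero hq' (by simpa using hs))
    (one_sub_cpow_ne_zero hq' (by simpa using hs)) (one_sub_cpow_ne_zero hq' (by simpa using hs))
    (one_sub_cpow_ne_zero hq' hs)

/-- **`Σ_{(r,N)=1} κ(r)r^{−s} = λ(N,s)ζ(s+β₁)ζ(s+β₂)ζ(s+β₃)/ζ(s)`** (`N ≥ 1`, `Re s > 1`): the second
factor of the identity `Z22:§7.u045`. [cite: Zhang2022LandauSiegel, §7 p.40, tex L2101] -/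
theorem LSeries_indicator_coprime_kappaZ (hs : 1 < s.re) {N : ℕ} (hN : N ≠ 0) :
    LSeries ({r | Nat.Coprime r N}.indicator fun n => Skeleton.kappaZ c' D n) s =
      Skeleton.lam c' D N s * Section7dStatements.zetaRatio c' D s := by
  have key := LSeries_indicator_coprime_mul (Skeleton.b1 c' D) (Skeleton.b2 c' D) (Skeleton.b3 c' D)
    hs hN
  have hlam := lam_mul_prod_eq_one c' D (by linarith : 0 < s.re) N
  rw [← LSeries_kappaZ c' D hs, Skeleton.kappaZ, ← key]
  set P := ∏ q ∈ N.primeFactors, (1 - (q : ℂ) ^ (-(s + Skeleton.b1 c' D * I)))⁻¹ *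
      (1 - (q : ℂ) ^ (-(s + Skeleton.b2 c' D * I)))⁻¹ *
      (1 - (q : ℂ) ^ (-(s + Skeleton.b3 c' D * I)))⁻¹ * (1 - (q : ℂ) ^ (-s))
  calc LSeries ({r | Nat.Coprime r N}.indicator fun n => kappa (Skeleton.b1 c' D) (Skeleton.b2 c' D)
          (Skeleton.b3 c' D) n) s
      = (Skeleton.lam c' D N s * P) * LSeries ({r | Nat.Coprime r N}.indicator fun n =>
          kappa (Skeleton.b1 c' D) (Skeleton.b2 c' D) (Skeleton.b3 c' D) n) s := by rw [hlam, one_mul]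
    _ = _ := by ring

variable {c' D}

/-- The `L`-series of `h ↦ 𝟙[h ∈ 𝔫(d₁), (h,m)=1]κ(d₁h)` is Zhang's `κ̃(d₁;m,s)` (termwise).
[cite: Zhang2022LandauSiegel, §7 p.32, tex L1791] -/
theorem LSeries_eq_kappaTilde (d₁ m : ℕ) (s : ℂ) :
    LSeries ({h | h ∈ Skeleton.nset d₁ ∧ Nat.Coprime h m}.indicator fun h => Skeleton.kappaZ c' D (d₁ * h)) s =
      Skeleton.kappaTilde c' D d₁ m s := by
  rw [Skeleton.kappaTilde, LSeries]
  refine tsum_congr fun h => ?_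
  by_cases hh : h ∈ Skeleton.nset d₁ ∧ Nat.Coprime h m
  · rw [if_pos hh, LSeries.term_of_ne_zero hh.1.1.ne', Set.indicator_of_mem (by exact hh)]
  · rw [if_neg hh]
    rcases eq_or_ne h 0 with rfl | h0
    · simp
    · rw [LSeries.term_of_ne_zero h0, Set.indicator_of_notMem (by exact hh), zero_div]

/-- Absolute convergence of `κ̃(d₁;m,s)`'s series for `Re s > 1` (a sub-series of `Σ|κ(n)|n^{−σ}`
along the multiples of `d₁`, times `d₁^σ`). [folklore] -/
private theorem lseriesSummable_kappaTilde (hs : 1 < s.re) {d₁ : ℕ} (hd₁ : d₁ ≠ 0) (m : ℕ) :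
    LSeriesSummable
      ({h | h ∈ Skeleton.nset d₁ ∧ Nat.Coprime h m}.indicator fun h => Skeleton.kappaZ c' D (d₁ * h)) s := by
  have hκ := LSeriesSummable_kappa (Skeleton.b1 c' D) (Skeleton.b2 c' D) (Skeleton.b3 c' D) hs
  have hsub : Summable fun h : ℕ => ‖(d₁ : ℂ) ^ s‖ *
      ‖term (fun n => Skeleton.kappaZ c' D n) s (d₁ * h)‖ :=
    ((hκ.norm.comp_injective (mul_right_injective₀ hd₁))).mul_left _
  refine Summable.of_norm_bounded hsub fun h => ?_
  rcases eq_or_ne h 0 with rfl | h0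
  · simp
  have hd0 : (d₁ : ℂ) ≠ 0 := by exact_mod_cast hd₁
  have hds : (d₁ : ℂ) ^ s ≠ 0 := (Complex.cpow_ne_zero_iff_of_exponent_ne_zero
    (by intro h; rw [h, Complex.zero_re] at hs; linarith)).mpr hd0
  rw [LSeries.term_of_ne_zero h0,
    LSeries.term_of_ne_zero (mul_ne_zero hd₁ h0), ← norm_mul, Nat.cast_mul,
    Complex.natCast_mul_natCast_cpow, mul_div_assoc', mul_div_mul_left _ _ hds, norm_div, norm_div]
  exact div_le_div_of_nonneg_right (norm_indicator_le_norm_self _ _) (norm_nonneg _)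

/-- **The splitting of the series in `Z22:§7.u045`**: for `l ≥ 1`,
`𝟙[(l,m)=1]κ(d₁l) = (𝟙[h∈𝔫(d₁),(h,m)=1]κ(d₁h) ∗ 𝟙[(r,d₁m)=1]κ(r))(l)` — every `l` coprime to `m` is
uniquely `hr` with `h ∈ 𝔫(d₁)`, `(h,m) = 1`, `(r, d₁m) = 1`, and `κ(d₁hr) = κ(d₁h)κ(r)`.
[cite: Zhang2022LandauSiegel, §7 p.40, tex L2100] -/
theorem split_conv_apply {d₁ m : ℕ} (hd₁ : d₁ ≠ 0) (hm : m ≠ 0) {l : ℕ} (hl : l ≠ 0) :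
    (({h | h ∈ Skeleton.nset d₁ ∧ Nat.Coprime h m}.indicator fun h => Skeleton.kappaZ c' D (d₁ * h)) ⍟
        ({r | Nat.Coprime r (d₁ * m)}.indicator fun n => Skeleton.kappaZ c' D n)) l =
      if Nat.Coprime l m then Skeleton.kappaZ c' D (d₁ * l) else 0 := by
  obtain ⟨a, b, hab, ha, hb⟩ := exists_split d₁.primeFactors hl
  have hA : ∀ a, a ∉ Nat.factoredNumbers d₁.primeFactors →
      {h | h ∈ Skeleton.nset d₁ ∧ Nat.Coprime h m}.indicator
        (fun h => Skeleton.kappaZ c' D (d₁ * h)) a = 0 := fun a ha =>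
    Set.indicator_of_notMem (fun h => ha ((mem_nset_iff hd₁).mp h.1)) _
  have hB : ∀ b, ∀ q ∈ d₁.primeFactors, q.Prime → q ∣ b →
      {r | Nat.Coprime r (d₁ * m)}.indicator (fun n => Skeleton.kappaZ c' D n) b = 0 :=
    fun b q hq _ hqb => indicator_coprime_eq_zero _
      (Nat.primeFactors_mono (dvd_mul_right d₁ m) (mul_ne_zero hd₁ hm) hq) hqb
  rw [convolution_eq_of_split hA hB hl hab ha hb]
  have had : Nat.Coprime b d₁ := coprime_of_split' hb hd₁ subset_rfl
  have hba : Nat.Coprime b a := coprime_of_split hb ha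
  have ha' : a ∈ Skeleton.nset d₁ := (mem_nset_iff hd₁).mpr ha
  have ha0 : a ≠ 0 := ha'.1.ne'
  by_cases hlm : Nat.Coprime l m
  · have ham : Nat.Coprime a m := Nat.Coprime.coprime_dvd_left ⟨b, hab.symm⟩ hlm
    have hbm : Nat.Coprime b m := Nat.Coprime.coprime_dvd_left ⟨a, by rw [mul_comm]; exact hab.symm⟩ hlm
    have hbdm : Nat.Coprime b (d₁ * m) := Nat.Coprime.mul_right had hbm
    rw [if_pos hlm, Set.indicator_of_mem (show a ∈ {h | h ∈ Skeleton.nset d₁ ∧ Nat.Coprime h m} from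
      ⟨ha', ham⟩), Set.indicator_of_mem (show b ∈ {r | Nat.Coprime r (d₁ * m)} from hbdm),
      ← (show (Skeleton.kappaZ c' D).IsMultiplicative from isMultiplicative_kappa _ _ _).map_mul_of_coprime
        (show Nat.Coprime (d₁ * a) b from Nat.Coprime.mul_left had.symm hba.symm), mul_assoc, hab]
  · rw [if_neg hlm]
    by_cases ham : Nat.Coprime a m
    · have hbm : ¬ Nat.Coprime b m := fun hbm => hlm (hab ▸ Nat.Coprime.mul_left ham hbm)
      rw [Set.indicator_of_notMem (show b ∉ {r | Nat.Coprime r (d₁ * m)} from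
        fun h => hbm (Nat.Coprime.coprime_mul_left_right h)), mul_zero]
    · rw [Set.indicator_of_notMem (show a ∉ {h | h ∈ Skeleton.nset d₁ ∧ Nat.Coprime h m} from
        fun h => ham h.2), zero_mul]

/-- **`Z22:§7.u045` DISCHARGED** (§7 p. 40, tex L2101): "Hence
`Σ_{(l,kd₂)=1} κ(d₁l)l^{−s} = κ̃(d₁;d₂k,s)λ(d₁d₂k,s)·ζ(s+β₁)ζ(s+β₂)ζ(s+β₃)/ζ(s)`" — as typed by
`Section7dStatements.Step7u045` (`σ > 1`, `m = d₂k`). Proof: the splitting `l = hr`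
(`split_conv_apply`), `L`-series of a Dirichlet convolution = product, and the Euler-product
evaluation `Σ_{(r,N)=1}κ(r)r^{−s} = λ(N,s)Σ_nκ(n)n^{−s}` (`LSeries_indicator_coprime_kappaZ`).
[cite: Zhang2022LandauSiegel, §7 p.40, tex L2101] -/
theorem _root_.Literature.NumberTheory.LFunctions.Zhang2022.Section7dStatements.step7u045_holds
    (c' : ℝ) : Section7dStatements.Step7u045 c' := by
  intro D d₁ m hd₁ hm s hs
  have hd0 : d₁ ≠ 0 := hd₁.ne'
  have hm0 : m ≠ 0 := hm.ne'
  have hκ := LSeriesSummable_kappa (Skeleton.b1 c' D) (Skeleton.b2 c' D) (Skeleton.b3 c' D) hs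
  have hA := lseriesSummable_kappaTilde (c' := c') (D := D) hs hd0 m
  have hB : LSeriesSummable ({r | Nat.Coprime r (d₁ * m)}.indicator fun n => Skeleton.kappaZ c' D n) s :=
    lseriesSummable_of_norm_le hκ fun n => norm_indicator_le_norm_self _ _
  rw [Section7dStatements.kapSer, ← LSeries_eq_kappaTilde, mul_assoc,
    ← LSeries_indicator_coprime_kappaZ c' D hs (mul_ne_zero hd0 hm0), ← LSeries_convolution' hA hB]
  exact LSeries_congr (fun hl => (split_conv_apply hd0 hm0 hl).symm) s

variable (c' : ℝ) in
/-- `Step7u045` — `_holds` alias of `step7u045_holds` above under the fact's exact name, stated under the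
prover's own binders as section variables (appended 2026-08-28, D-0026 bookkeeping: the proof term is the
existing theorem of this file; no statement, definition or attribute is edited; no new named fact; the
ledger's debt table listed the fact unproved). [cite: Zhang2022LandauSiegel, §7 p.40, tex L2101] -/
theorem _root_.Literature.NumberTheory.LFunctions.Zhang2022.Section7dStatements.Step7u045_holds :
    _root_.Literature.NumberTheory.LFunctions.Zhang2022.Section7dStatements.Step7u045 c' :=
  _root_.Literature.NumberTheory.LFunctions.Zhang2022.Section7dStatements.step7u045_holds (c' := c')

end Zhang

end Literature.NumberTheory.LFunctions.Zhang2022.KappaEuler
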